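/-
Copyright (c) 2026 the pub-hodgecm-mathlib formalisation cell (harness21).  Prover seat hodgecm-mathlib-F0P3b-p01 (g26); E1 keeper ∕ dealer F0P3a-p03 (g31) k23
«= cut + order» 2026-09-03T05:24:36Z on CENSUS-R68 v1 607db827 (E1 BRICK LEDGER row 68-A DATUM «EVERY MEMBER IS A SUB»; 68-A GENERIC = ★ F0P3-p02 (g27)).
-/
import Summits.HodgeConjecture.HodgeConjecture.Theorems.F0P3cStCharTSLdsLabelledPair         -- ★ row 64-B (this seat) p853559: `ldsLabelledPair_of_two_constituents`; brings ★ N2∕N3-holds, ★ `isAdmissible_cmPrincipalSeries`, ★ `cmWeylTorusCharPair_eq_of_apply_fixed_eq_one`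
import Summits.HodgeConjecture.HodgeConjecture.Theorems.F0P3bCentralCharacterUnitaryNonsplit  -- ★ `exists_isOpen_isCompact_subgroup_cmLocal` (the compact open `K` of admissible Schur)
import Literature.NumberTheory.Automorphic.IrreducibleEmbeddingSchurPairOfEmbedding           -- ★ row 68-A GENERIC (F0P3-p02 (g27)): `IrrClass.exists_realisation_schurPair_of_injective_normalizedInd`
import HarnessLib

/-!
# F0 · P3c · «StCharTS» K4′ column — E1 row 68-A DATUM «EVERY MEMBER IS A SUB»: in case (3) EACH of the two members of `Π(θ) = JH(i_B(θ̃))` is realised as an invariant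
# irreducible SUB `A ≤ I₀ = i_B(θ̃)` with `Hom_G(A, I₀ ∕ A) = 0`, Schur, the other member as the quotient, and `r_B(I₀ ∕ A) ≠ 0`
# [Rogawski1990, §12.2 (3) pp. 173–174; Keys1984 §7 Thm. (1) p. 126; Casselman1995 Cor. 6.3.9 (b), §7.1]

Cell `pub/hodgecm-mathlib`, crux H413 = `stmt-HodgeConjecture-24833` (`--supports` lane, `--as helper`-class: THEOREMS ONLY, no definition ∕ instance ∕ notation ∕ named fact ∕ `sorry`),
route HCCMUnconditional.  E1 BRICK LEDGER (keeper F0P3a-p03 (g31)) row 68-A DATUM; TEXT 4 `hLdsOne` of the organ (S-𝔑) quantifies over BOTH members `π ∈ P`, while ★ 64-C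
`F0P3cStCharTSLdsRealisation.exists_ldsRealisation_schurPair` realises only the labelled member `πs` as the sub.  Namespace `Summit.HodgeConjecture.HodgeConjecture.Cruxes.H413.F0P3cStCharTSLdsRealisationBoth`.

THE MATHEMATICS.  `G = Gqs L v`, `v` non-split, `χ = (χ₁, χ₂)` continuous with `χ₁|_{F_v^×} ≡ 1` (case (3)), `I₀ := i_G(χ) = normalizedInd (cmBorelTriple L 3 v) (𝟙 ⊗ χ)`, two distinct constituents
(`htwo` = rung 0's `hLdsRedTwo` residue, carried).  By ★ N2 [Casselman1995, Cor. 6.3.9 (b)] a representative `r` of ANY constituent `c` embeds into `i_G(χ)` or into `i_G(wχ)`; in case (3)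
`wχ = χ` (★ `cmWeylTorusCharPair_eq_of_apply_fixed_eq_one`), so `r ↪ I₀` either way (§1 transports the second embedding along the equality of the inducing characters); ★ 68-A GENERIC
`exists_realisation_schurPair_of_injective_normalizedInd` then turns the embedding into the SENTENCE's letters `(A hAinv hAirr hHom0 hSchur)` with `⟦I₀|_A⟧ = c`, `⟦I₀∕A⟧ = c′` (the other
member, by ★ 64-B's `hJH`), and `r_B(I₀∕A) ≠ 0` (★ 64-B's one-dimensional Jacquet module of `c′`).
* §1 `exists_equiv_cmPrincipalSeries_of_eq` — `χ = χ′ ⇒ i_G(χ) ≃ i_G(χ′)` (by `subst`; the carrier-level transport done ONCE, generically in the character).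
* §2 `exists_injective_intertwiningMap_of_isConstituentOf` — in case (3) EVERY constituent embeds into `i_G(χ)` (★ N2 + §1).
* §3 `exists_ldsRealisation_schurPair_of_injective` — ★ 68-A GENERIC at the datum for a GIVEN embedded labelled member (ONE δ-paying call; 64-B∕64-C budget class).
* §4 **`exists_ldsRealisation_schurPair_of_mem`** — for every constituent `c` of `I₀`: `∃ c′ ≠ c` with `JH(I₀) = {c′, c}` and ★ 68-A GENERIC's six conjuncts at `πs := c`, `πn := c′`
  (light assembly over ★ 64-B, §2, §3 — keeper k60: one generic call per lemma, each ≤ 2·10⁷ heartbeats).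
HONEST LABEL: count-neutral datum helper; the only non-★ binder is `htwo` = rung 0's (R1)+(R2) [Keys1984 §7 Thm. (1); Rogawski1990 p. 174], carried not asserted; h413 OPEN; HC_CM is
proved only modulo the 7 printed citations (2 remaining named inputs hLiu418 = stmt-HodgeConjecture-24832, h413 = stmt-HodgeConjecture-24833) until rung 0 closes.

## References
* [Rogawski1990] J. D. Rogawski, *Automorphic Representations of Unitary Groups in Three Variables*, Ann. of Math. Stud. 123 (1990), §12.2 p. 173 ll. 8–12 and (3) pp. 173–174.
* [Keys1984] D. Keys, *Principal series representations of special unitary groups over local fields*, Compositio Math. 51 (1984), §7 Thm. p. 126.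
* [Casselman1995] W. Casselman, *Introduction to the theory of admissible representations of p-adic reductive groups* (draft 1995), Thm 3.2.4, Cor. 6.3.9 (b), §7.1 Cor. 7.1.2.
* [BernsteinZelevinsky1977] I. N. Bernstein, A. V. Zelevinsky, *Induced representations of reductive p-adic groups I*, Ann. Sci. ÉNS 10 (1977), Prop. 1.9 (b), §2.3.
-/

set_option autoImplicit false
-- the mandated namespace has the single-problem summit's repeated segment (`HodgeConjecture.HodgeConjecture`)
set_option linter.dupNamespace false

noncomputable section

open NumberField IsDedekindDomain
open scoped Matrix
open Literature.NumberTheory.Rogawski1990 Literature.NumberTheory.Automorphic Literature.NumberTheory.Automorphic.UnitaryGroup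
open Summit.HodgeConjecture.HodgeConjecture.Cruxes.H413

namespace Summit.HodgeConjecture.HodgeConjecture.Cruxes.H413.F0P3cStCharTSLdsRealisationBoth

variable (L : Type) [Field L] [NumberField L] [IsCMField L] (v : HeightOneSpectrum (𝓞 ↥(maximalRealSubfield L)))

/-! ## §1 Equal inducing characters give equivalent principal series -/

/-- **`χ = χ′ ⇒ i_G(χ) ≃ i_G(χ′)`** (the identity, after substituting the character) — used to read an embedding into `i_G(wχ)` as an embedding into `i_G(χ)` in case (3), where
`wχ = χ`. [cite: Rogawski1990, §12.2 p. 173] -/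
theorem exists_equiv_cmPrincipalSeries_of_eq
    (χ χ' : ↥(torusU (conjLocal L (IsCMField.complexConj L) v) (cmLocalForm L 3 v)) →* ℂˣ) (h : χ = χ') :
    Nonempty ((cmPrincipalSeries L 3 v χ).Equiv (cmPrincipalSeries L 3 v χ')) := by
  subst h
  exact ⟨Representation.Equiv.refl _⟩

/-! ## §2 Every constituent embeds into `i_G(χ)` in case (3) -/

set_option synthInstance.maxHeartbeats 400000 in
set_option maxHeartbeats 20000000 in  -- ★ N2's def-term at the CM carrier + one `Equiv` composition (64-B∕64-C budget class, ★ `F0P3KeysLabelledPair` ELABORATION NOTE)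
/-- **In case (3) EVERY constituent of `i_G(χ)` EMBEDS INTO `i_G(χ)`**: ★ N2 [Casselman1995, Cor. 6.3.9 (b)] embeds a representative into `i_G(χ)` or `i_G(wχ)`, and `wχ = χ`
(★ `cmWeylTorusCharPair_eq_of_apply_fixed_eq_one`, §1). [cite: Casselman1995, Cor. 6.3.9 (b), Thm 3.2.4] [cite: Rogawski1990, §12.2 (3) pp. 173–174] -/
theorem exists_injective_intertwiningMap_of_isConstituentOf (hns : ∀ w : PlacesOver L v, IsCMField.complexConj L • w.1 = w.1)
    (χ₁ : (LocalRing L v)ˣ →* ℂˣ) (χ₂ : ↥(normOneUnits (conjLocal L (IsCMField.complexConj L) v)) →* ℂˣ)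
    (hc1 : Continuous (fun x => ((χ₁ x : ℂˣ) : ℂ))) (hc2 : Continuous (fun x => ((χ₂ x : ℂˣ) : ℂ)))
    (htriv : ∀ a : (LocalRing L v)ˣ, (conjLocal L (IsCMField.complexConj L) v) (a : LocalRing L v) = a → χ₁ a = 1)
    (c : IrrClass (Gqs L v)) (hc : c.IsConstituentOf (cmPrincipalSeries L 3 v (cmTorusCharPair L v χ₁ χ₂))) :
    ∃ r : SmoothIrrep (Gqs L v), IrrClass.mk r = c ∧ ∃ f : r.ρ.IntertwiningMap (cmPrincipalSeries L 3 v (cmTorusCharPair L v χ₁ χ₂)), Function.Injective f := by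
  have hemb := F0P3U3PrincipalSeriesLettersHold.u3PrincipalSeriesConstituentEmbeds_holds L v hns χ₁ χ₂ hc1 hc2 c hc
  have hw := F0P3cStCharTSWeylFixedIffNormTrivial.cmWeylTorusCharPair_eq_of_apply_fixed_eq_one L v χ₁ χ₂ htriv
  have ew := exists_equiv_cmPrincipalSeries_of_eq L v _ _ hw
  cases hemb with
  | intro r hr =>
  cases hr with
  | intro hrc hor =>
  refine ⟨r, hrc, ?_⟩
  cases hor with
  | inl h1 => exact h1
  | inr h2 =>
    cases h2 with
    | intro f' hf' =>
    cases ew with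
    | intro e => exact ⟨e.toIntertwiningMap.comp f', e.toLinearEquiv.injective.comp hf'⟩

/-! ## §3 The realisation package at the datum, for a GIVEN embedded member (one call of ★ 68-A GENERIC) -/

set_option synthInstance.maxHeartbeats 400000 in
set_option maxHeartbeats 20000000 in  -- `cmPrincipalSeries L 3 v χ = normalizedInd (cmBorelTriple L 3 v) (𝟙 ⊗ χ)` by δ at the CM carrier, ONE call (64-B∕64-C budget class)
/-- **★ 68-A GENERIC at the CM datum**: for a labelled pair `πs ≠ πn` of `I₀ = i_G(χ₁, χ₂)` (`hJH`), a representative `r` of `πs` EMBEDDED in `I₀` (`f hf`) and the Jacquet line of `πn`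
(`hn`, any character `θ₁` of the torus — ★ 64-B hands `χ` for one member and `wχ` for the other): the six conjuncts `(A hAinv) hAirr hHom0 hSchur`, `⟦I₀|_A⟧ = πs`, `⟦I₀∕A⟧ = πn`,
`r_B(I₀∕A) ≠ 0`, spelt over `normalizedInd (cmBorelTriple L 3 v) (𝟙 ⊗ χ)` EXACTLY as ★ 64-C. [cite: Casselman1995, Thm 3.2.4, Cor. 6.3.9 (b), Cor. 7.1.2] [cite: Rogawski1990, §12.2 (3) pp. 173–174]
[cite: BernsteinZelevinsky1977, Prop. 1.9 (b), §2.3] -/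
theorem exists_ldsRealisation_schurPair_of_injective (hns : ∀ w : PlacesOver L v, IsCMField.complexConj L • w.1 = w.1)
    (χ₁ : (LocalRing L v)ˣ →* ℂˣ) (χ₂ : ↥(normOneUnits (conjLocal L (IsCMField.complexConj L) v)) →* ℂˣ)
    (hc1 : Continuous (fun x => ((χ₁ x : ℂˣ) : ℂ))) (hc2 : Continuous (fun x => ((χ₂ x : ℂˣ) : ℂ)))
    {πs πn : IrrClass (Gqs L v)} (hne : πs ≠ πn)
    (hJH : ∀ d : IrrClass (Gqs L v), d.IsConstituentOf (cmPrincipalSeries L 3 v (cmTorusCharPair L v χ₁ χ₂)) ↔ (d = πn ∨ d = πs))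
    (r : SmoothIrrep (Gqs L v)) (hr : IrrClass.mk r = πs)
    (f : r.ρ.IntertwiningMap (cmPrincipalSeries L 3 v (cmTorusCharPair L v χ₁ χ₂))) (hf : Function.Injective f)
    {θ₁ : ↥(torusU (conjLocal L (IsCMField.complexConj L) v) (cmLocalForm L 3 v)) →* ℂˣ}
    (hn : haveI := locallyCompactSpace_cmBorelU L 3 v
      ∃ r' : SmoothIrrep (Gqs L v), IrrClass.mk r' = πn ∧
        Nonempty ((r'.ρ.normalizedJacquet (cmBorelTriple L 3 v)).Equiv
          ((Representation.trivial ℂ ↥(torusU (conjLocal L (IsCMField.complexConj L) v) (cmLocalForm L 3 v)) ℂ).twist θ₁))) :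
    haveI := locallyCompactSpace_cmBorelU L 3 v
    ∃ (A : Submodule ℂ (Representation.SmoothInd (cmBorelTriple L 3 v).P
            (Representation.twist (((Representation.trivial ℂ ↥(cmBorelTriple L 3 v).M ℂ).twist (cmTorusCharPair L v χ₁ χ₂)).comp (cmBorelTriple L 3 v).proj)
              (rootDeltaChar (cmBorelTriple L 3 v).P))))
        (hAinv : ∀ g, A ≤ A.comap (Representation.normalizedInd (cmBorelTriple L 3 v)
          ((Representation.trivial ℂ ↥(cmBorelTriple L 3 v).M ℂ).twist (cmTorusCharPair L v χ₁ χ₂)) g)),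
        (∀ B : Submodule ℂ _, B ≤ A →
            (∀ g, B ≤ B.comap (Representation.normalizedInd (cmBorelTriple L 3 v)
              ((Representation.trivial ℂ ↥(cmBorelTriple L 3 v).M ℂ).twist (cmTorusCharPair L v χ₁ χ₂)) g)) → B = ⊥ ∨ B = A) ∧
        (∀ ψ : Representation.IntertwiningMap
            ((Representation.normalizedInd (cmBorelTriple L 3 v) ((Representation.trivial ℂ ↥(cmBorelTriple L 3 v).M ℂ).twist (cmTorusCharPair L v χ₁ χ₂))).subrepresentation A hAinv)
            ((Representation.normalizedInd (cmBorelTriple L 3 v) ((Representation.trivial ℂ ↥(cmBorelTriple L 3 v).M ℂ).twist (cmTorusCharPair L v χ₁ χ₂))).quotient A hAinv),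
            ψ = 0) ∧
        Module.finrank ℂ (Representation.IntertwiningMap
            ((Representation.normalizedInd (cmBorelTriple L 3 v) ((Representation.trivial ℂ ↥(cmBorelTriple L 3 v).M ℂ).twist (cmTorusCharPair L v χ₁ χ₂))).subrepresentation A hAinv)
            ((Representation.normalizedInd (cmBorelTriple L 3 v) ((Representation.trivial ℂ ↥(cmBorelTriple L 3 v).M ℂ).twist (cmTorusCharPair L v χ₁ χ₂))).subrepresentation A hAinv)) = 1 ∧
        (∃ (hirr : ((Representation.normalizedInd (cmBorelTriple L 3 v)
              ((Representation.trivial ℂ ↥(cmBorelTriple L 3 v).M ℂ).twist (cmTorusCharPair L v χ₁ χ₂))).subrepresentation A hAinv).IsIrreducible)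
            (hsm : ((Representation.normalizedInd (cmBorelTriple L 3 v)
              ((Representation.trivial ℂ ↥(cmBorelTriple L 3 v).M ℂ).twist (cmTorusCharPair L v χ₁ χ₂))).subrepresentation A hAinv).IsSmooth),
          IrrClass.mk (SmoothIrrep.mk ↥A _ hirr hsm) = πs) ∧
        (∃ (hirr : ((Representation.normalizedInd (cmBorelTriple L 3 v)
              ((Representation.trivial ℂ ↥(cmBorelTriple L 3 v).M ℂ).twist (cmTorusCharPair L v χ₁ χ₂))).quotient A hAinv).IsIrreducible)
            (hsm : ((Representation.normalizedInd (cmBorelTriple L 3 v)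
              ((Representation.trivial ℂ ↥(cmBorelTriple L 3 v).M ℂ).twist (cmTorusCharPair L v χ₁ χ₂))).quotient A hAinv).IsSmooth),
          IrrClass.mk (SmoothIrrep.mk (_ ⧸ A) _ hirr hsm) = πn) ∧
        Nontrivial ((cmBorelTriple L 3 v).restrict ((Representation.normalizedInd (cmBorelTriple L 3 v)
          ((Representation.trivial ℂ ↥(cmBorelTriple L 3 v).M ℂ).twist (cmTorusCharPair L v χ₁ χ₂))).quotient A hAinv)).Coinvariants := by
  haveI := locallyCompactSpace_cmBorelU L 3 v
  obtain ⟨K, hKo, hKc⟩ := F0P3bCentralCharacterUnitaryNonsplit.exists_isOpen_isCompact_subgroup_cmLocal L 3 v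
  have hadm := F0P3XiUnramNonsplitInstance.isAdmissible_cmPrincipalSeries L v (cmTorusCharPair L v χ₁ χ₂)
  have hlen := F0P3U3PrincipalSeriesLettersHold.u3PrincipalSeriesLengthLeTwo_holds L v hns χ₁ χ₂ hc1 hc2
  exact IrrClass.exists_realisation_schurPair_of_injective_normalizedInd (cmBorelTriple L 3 v) hadm hKo hKc hlen hne hJH r hr f hf hn

/-! ## §4 Every member of the l.d.s. packet is a sub -/

set_option synthInstance.maxHeartbeats 400000 in
set_option maxHeartbeats 20000000 in  -- statement-heavy (the CM carrier); the body is a light assembly over §2–§3 and ★ 64-B (no δ-unfolding here)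
/-- **E1 ROW 68-A DATUM — EVERY MEMBER IS A SUB.**  At a finite place `v` of `L⁺` non-split in `L`, for continuous `χ₁, χ₂` with `χ₁` trivial on the `σ`-fixed units (case (3)) and two distinct
constituents of `I₀ = i_G(χ₁, χ₂)` (`htwo`, rung 0's `hLdsTwo` residue, carried): for EVERY constituent `c` of `I₀` there are the other constituent `c′ ≠ c` (so that `JH(I₀) = {c′, c}`) and an
invariant `A ≤ I₀ = normalizedInd (cmBorelTriple L 3 v) (𝟙 ⊗ χ)` with: no invariant submodule strictly between `⊥` and `A` (`hAirr`), `Hom_G(I₀|_A, I₀∕A) = 0` (`hHom0`), `dim End_G(I₀|_A) = 1`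
(`hSchur`), `⟦I₀|_A⟧ = c`, `⟦I₀∕A⟧ = c′`, and `r_B(I₀∕A) ≠ 0`.  Proof: ★ 64-B gives the labelled pair `(πs, πn)` with one-dimensional Jacquet modules; `c ∈ {πs, πn}`; ★ N2 embeds a
representative of `c` into `i_G(χ)` or `i_G(wχ) ≃ i_G(χ)` (§1, `wχ = χ` ★); ★ 68-A GENERIC at `πs := c`, `πn := c′` with `hn` = ★ 64-B's Jacquet line of `c′` (at `θ₁ := wχ` or `θ₁ := χ`).
[cite: Rogawski1990, §12.2 (3) pp. 173–174] [cite: Keys1984, §7 Thm. p. 126] [cite: Casselman1995, Thm 3.2.4, Cor. 6.3.9 (b), Cor. 7.1.2] [cite: BernsteinZelevinsky1977, Prop. 1.9 (b), §2.3] -/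
theorem exists_ldsRealisation_schurPair_of_mem (hns : ∀ w : PlacesOver L v, IsCMField.complexConj L • w.1 = w.1)
    (χ₁ : (LocalRing L v)ˣ →* ℂˣ) (χ₂ : ↥(normOneUnits (conjLocal L (IsCMField.complexConj L) v)) →* ℂˣ)
    (hc1 : Continuous (fun x => ((χ₁ x : ℂˣ) : ℂ))) (hc2 : Continuous (fun x => ((χ₂ x : ℂˣ) : ℂ)))
    (htriv : ∀ a : (LocalRing L v)ˣ, (conjLocal L (IsCMField.complexConj L) v) (a : LocalRing L v) = a → χ₁ a = 1)
    (htwo : ∃ c₁ c₂ : IrrClass (Gqs L v), c₁ ≠ c₂ ∧ c₁.IsConstituentOf (cmPrincipalSeries L 3 v (cmTorusCharPair L v χ₁ χ₂)) ∧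
      c₂.IsConstituentOf (cmPrincipalSeries L 3 v (cmTorusCharPair L v χ₁ χ₂)))
    (c : IrrClass (Gqs L v)) (hc : c.IsConstituentOf (cmPrincipalSeries L 3 v (cmTorusCharPair L v χ₁ χ₂))) :
    haveI := locallyCompactSpace_cmBorelU L 3 v
    ∃ c' : IrrClass (Gqs L v), c' ≠ c ∧
      (∀ d : IrrClass (Gqs L v), d.IsConstituentOf (cmPrincipalSeries L 3 v (cmTorusCharPair L v χ₁ χ₂)) ↔ (d = c' ∨ d = c)) ∧
      ∃ (A : Submodule ℂ (Representation.SmoothInd (cmBorelTriple L 3 v).P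
            (Representation.twist (((Representation.trivial ℂ ↥(cmBorelTriple L 3 v).M ℂ).twist (cmTorusCharPair L v χ₁ χ₂)).comp (cmBorelTriple L 3 v).proj)
              (rootDeltaChar (cmBorelTriple L 3 v).P))))
        (hAinv : ∀ g, A ≤ A.comap (Representation.normalizedInd (cmBorelTriple L 3 v)
          ((Representation.trivial ℂ ↥(cmBorelTriple L 3 v).M ℂ).twist (cmTorusCharPair L v χ₁ χ₂)) g)),
        (∀ B : Submodule ℂ _, B ≤ A →
            (∀ g, B ≤ B.comap (Representation.normalizedInd (cmBorelTriple L 3 v)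
              ((Representation.trivial ℂ ↥(cmBorelTriple L 3 v).M ℂ).twist (cmTorusCharPair L v χ₁ χ₂)) g)) → B = ⊥ ∨ B = A) ∧
        (∀ ψ : Representation.IntertwiningMap
            ((Representation.normalizedInd (cmBorelTriple L 3 v) ((Representation.trivial ℂ ↥(cmBorelTriple L 3 v).M ℂ).twist (cmTorusCharPair L v χ₁ χ₂))).subrepresentation A hAinv)
            ((Representation.normalizedInd (cmBorelTriple L 3 v) ((Representation.trivial ℂ ↥(cmBorelTriple L 3 v).M ℂ).twist (cmTorusCharPair L v χ₁ χ₂))).quotient A hAinv),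
            ψ = 0) ∧
        Module.finrank ℂ (Representation.IntertwiningMap
            ((Representation.normalizedInd (cmBorelTriple L 3 v) ((Representation.trivial ℂ ↥(cmBorelTriple L 3 v).M ℂ).twist (cmTorusCharPair L v χ₁ χ₂))).subrepresentation A hAinv)
            ((Representation.normalizedInd (cmBorelTriple L 3 v) ((Representation.trivial ℂ ↥(cmBorelTriple L 3 v).M ℂ).twist (cmTorusCharPair L v χ₁ χ₂))).subrepresentation A hAinv)) = 1 ∧
        (∃ (hirr : ((Representation.normalizedInd (cmBorelTriple L 3 v)
              ((Representation.trivial ℂ ↥(cmBorelTriple L 3 v).M ℂ).twist (cmTorusCharPair L v χ₁ χ₂))).subrepresentation A hAinv).IsIrreducible)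
            (hsm : ((Representation.normalizedInd (cmBorelTriple L 3 v)
              ((Representation.trivial ℂ ↥(cmBorelTriple L 3 v).M ℂ).twist (cmTorusCharPair L v χ₁ χ₂))).subrepresentation A hAinv).IsSmooth),
          IrrClass.mk (SmoothIrrep.mk ↥A _ hirr hsm) = c) ∧
        (∃ (hirr : ((Representation.normalizedInd (cmBorelTriple L 3 v)
              ((Representation.trivial ℂ ↥(cmBorelTriple L 3 v).M ℂ).twist (cmTorusCharPair L v χ₁ χ₂))).quotient A hAinv).IsIrreducible)
            (hsm : ((Representation.normalizedInd (cmBorelTriple L 3 v)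
              ((Representation.trivial ℂ ↥(cmBorelTriple L 3 v).M ℂ).twist (cmTorusCharPair L v χ₁ χ₂))).quotient A hAinv).IsSmooth),
          IrrClass.mk (SmoothIrrep.mk (_ ⧸ A) _ hirr hsm) = c') ∧
        Nontrivial ((cmBorelTriple L 3 v).restrict ((Representation.normalizedInd (cmBorelTriple L 3 v)
          ((Representation.trivial ℂ ↥(cmBorelTriple L 3 v).M ℂ).twist (cmTorusCharPair L v χ₁ χ₂))).quotient A hAinv)).Coinvariants := by
  haveI := locallyCompactSpace_cmBorelU L 3 v
  -- the labelled pair (★ 64-B)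
  have H := F0P3cStCharTSLdsLabelledPair.ldsLabelledPair_of_two_constituents L v hns χ₁ χ₂ hc1 hc2 htriv htwo
  cases H with
  | intro πs H =>
  cases H with
  | intro πn H =>
  cases H with
  | intro hne H =>
  cases H with
  | intro hJH H =>
  cases H with
  | intro hs hn =>
  -- a representative of `c` embedded in `I₀` (§2)
  have hf := exists_injective_intertwiningMap_of_isConstituentOf L v hns χ₁ χ₂ hc1 hc2 htriv c hc
  cases hf with
  | intro r hr =>
  cases hr with
  | intro hrc hf =>
  cases hf with
  | intro f hf =>
  -- `c ∈ {πs, πn}`: realise `c` with the OTHER member as the quotient (§3, one call per branch — no δ here)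
  cases (hJH c).1 hc with
  | inl hcn =>
    -- `c = πn`: the other member is `πs`, whose Jacquet line is `χ` (★ 64-B's `hs`)
    subst hcn
    exact ⟨πs, hne, fun d => (hJH d).trans Or.comm,
      exists_ldsRealisation_schurPair_of_injective L v hns χ₁ χ₂ hc1 hc2 (Ne.symm hne) (fun d => (hJH d).trans Or.comm) r hrc f hf hs⟩
  | inr hcs =>
    -- `c = πs`: the other member is `πn`, whose Jacquet line is `wχ` (★ 64-B's `hn`)
    subst hcs
    exact ⟨πn, Ne.symm hne, hJH, exists_ldsRealisation_schurPair_of_injective L v hns χ₁ χ₂ hc1 hc2 hne hJH r hrc f hf hn⟩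

end Summit.HodgeConjecture.HodgeConjecture.Cruxes.H413.F0P3cStCharTSLdsRealisationBoth

end
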